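import Literature.NumberTheory.GaloisRepresentations.PadicCharacterSquareRoot
import Mathlib.FieldTheory.IsAlgClosed.Basic
import Mathlib.Algebra.Ring.GeomSum
import Mathlib.Data.Nat.Choose.Dvd
import Mathlib.Data.Nat.Factorization.Basic
import Mathlib.Topology.Algebra.Group.Compact
import Mathlib.Topology.Algebra.OpenSubgroup
import Mathlib.GroupTheory.Index
import Mathlib.Analysis.Normed.Ring.Ultra
import HarnessLib

/-!
# `N`-th roots of `p`-adic characters with values in the principal units (`p ∤ N`), roots of
# unity near `1`, and the prime-to-`p` residual order of a compact `p`-adic character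

Topic `Literature/NumberTheory/GaloisRepresentations`.  Theorem-only file (no named fact, no new
notion; one auxiliary `Subgroup`, the principal units of `ℚ̄_pˣ`), continuing
`PadicCharacterSquareRoot` (R. Taylor's square-root device on the pro-`p` group
`U¹ = {x : ‖x - 1‖ < 1}` of `ℚ̄_p = PadicAlgCl p`) from the exponent `2` to every exponent `N`
prime to `p`, and adding the two elementary facts about `U¹` used to reduce an arbitrary compact
`p`-adic character to a `U¹`-valued one (Clozel–Harris–Taylor 2008, proof of Lemma 4.1.6, p. 122:
"… is a 2-group on which `θ̄` vanishes.  As `l > 2` …"; Serre, *Local Fields*, Ch. XIV §4, the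
structure of the principal units: `U¹` is uniquely divisible by every integer prime to `p`):

* `PadicAlgCl.norm_pow_sub_pow_eq` — **`x ↦ x^N` is an isometry of `U¹` for `p ∤ N`**
  (`x^N - y^N = (x - y) ∑ x^i y^{N-1-i}`, the sum being `≡ N (mod 𝔪)`), hence injective;
  `PadicAlgCl.exists_norm_sub_one_lt_and_pow_eq` — it is onto `U¹` (of the roots `z_i` of
  `X^N - u`, `∏ (1 - z_i) = 1 - u` has norm `< 1`, so some `z_i ∈ U¹`);
  `exists_continuousMonoidHom_pow_eq_of_norm_sub_one_lt` — **every continuous `U¹`-valued character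
  of a topological group has a continuous `U¹`-valued `N`-th root** (`p ∤ N`), unique
  (`eq_of_pow_eq_pow_of_norm_sub_one_lt`).
* (a root of unity `ζ` with `‖ζ - 1‖ < ‖p‖` is `1`: this is the tree's
  `PadicAlgCl.eq_one_of_pow_eq_one_of_norm_sub_one_lt`, `LAdicCharacterUnramifiedAEProofs`, not
  repeated here.)
* `PadicAlgCl.norm_sub_one_lt_of_norm_pow_sub_one_lt` — for `p` odd and `‖y‖ ≤ 1`,
  `‖y^p - 1‖ < 1 ⇒ ‖y - 1‖ < 1` (`(y-1)^p ≡ y^p - 1 (mod p)`: no `p`-torsion in `𝒪ˣ/U¹ ≅ 𝔽̄_pˣ`);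
  whence `exists_pow_norm_sub_one_lt_of_compactSpace` — **for a compact group `G` and a
  continuous `Θ : G → ℚ̄_pˣ` there is `d ≥ 1` prime to `p` with `Θ^d` valued in `U¹`** (the
  open subgroup `Θ⁻¹(U¹)` has finite index `p^a d`), and `exists_pow_eq_one_of_isOpen_ker` (a
  homomorphism with open kernel on a compact group has values of bounded finite order).

Elementary (ultrametric inequality, `IsAlgClosed ℚ̄_p`, binomial theorem); no logarithm or
exponential.

## References

* R. Taylor, *On the meromorphic continuation of degree two L-functions*, Doc. Math. Extra Vol.
  Coates (2006), p. 777. [Taylor2006]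
* J.-P. Serre, *Local Fields*, GTM 67, Ch. XIV §4, Prop. 10 (structure of `U¹`). [SerreLocalFields1979]
* L. Clozel, M. Harris, R. Taylor, Publ. Math. IHÉS 108 (2008), proof of Lemma 4.1.6, pp. 121–122.
  [ClozelHarrisTaylor2008]
-/

noncomputable section

open Filter Topology Finset Polynomial

namespace Literature.NumberTheory.GaloisRepresentations

variable {p : ℕ} [Fact p.Prime]

/-! ### Norms of natural numbers in `ℚ̄_p` -/

/-- `‖n‖ = 1` in `ℚ̄_p` for `p ∤ n`. [folklore] -/
theorem PadicAlgCl.norm_natCast_eq_one_of_not_dvd' {n : ℕ} (hn : ¬p ∣ n) : ‖(n : PadicAlgCl p)‖ = 1 := by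
  rw [← map_natCast (algebraMap ℚ_[p] (PadicAlgCl p)) n]
  change ‖((n : ℚ_[p]) : PadicAlgCl p)‖ = 1
  rw [PadicAlgCl.norm_extends, Padic.norm_natCast_eq_one_iff]
  exact (Nat.Prime.coprime_iff_not_dvd Fact.out).2 hn

/-- `‖n‖ < 1` in `ℚ̄_p` for `p ∣ n`. [folklore] -/
theorem PadicAlgCl.norm_natCast_lt_one_of_dvd {n : ℕ} (hn : p ∣ n) : ‖(n : PadicAlgCl p)‖ < 1 := by
  rw [← map_natCast (algebraMap ℚ_[p] (PadicAlgCl p)) n]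
  change ‖((n : ℚ_[p]) : PadicAlgCl p)‖ < 1
  rw [PadicAlgCl.norm_extends, Padic.norm_natCast_lt_one_iff]
  exact hn

/-- `‖\binom{p}{j}‖ ≤ ‖p‖` for `0 < j < p`. [folklore] -/
theorem PadicAlgCl.norm_choose_le_norm_p {j : ℕ} (hj0 : j ≠ 0) (hjp : j < p) :
    ‖((p.choose j : ℕ) : PadicAlgCl p)‖ ≤ ‖(p : PadicAlgCl p)‖ := by
  obtain ⟨m, hm⟩ := (Fact.out : p.Prime).dvd_choose_self hj0 hjp
  rw [hm, Nat.cast_mul, norm_mul]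
  exact mul_le_of_le_one_right (norm_nonneg _) (IsUltrametricDist.norm_natCast_le_one (PadicAlgCl p) m)

/-! ### The principal units `U¹ = {‖x - 1‖ < 1}` -/

/-- `U¹` is closed under inverses: `x⁻¹ - 1 = -x⁻¹ (x - 1)`. [folklore] -/
theorem PadicAlgCl.norm_inv_sub_one_lt {x : PadicAlgCl p} (hx : ‖x - 1‖ < 1) : ‖x⁻¹ - 1‖ < 1 := by
  -- `‖x‖ = 1` (ultrametric; the tree's `norm_eq_one_of_norm_sub_one_lt_one`, not imported here)
  have hx1 : ‖x‖ = 1 := by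
    have h : ‖x - 1‖ ≠ ‖(1 : PadicAlgCl p)‖ := by rw [norm_one]; exact hx.ne
    have := IsUltrametricDist.norm_add_eq_max_of_norm_ne_norm h
    rwa [sub_add_cancel, norm_one, max_eq_right hx.le] at this
  have hx0 : x ≠ 0 := norm_pos_iff.1 (by rw [hx1]; exact one_pos)
  rw [show x⁻¹ - 1 = -(x⁻¹ * (x - 1)) by field_simp; ring, norm_neg, norm_mul, norm_inv, hx1,
    inv_one, one_mul]
  exact hx

/-- `U¹` is closed under powers. [folklore] -/
theorem PadicAlgCl.norm_pow_sub_one_lt {x : PadicAlgCl p} (hx : ‖x - 1‖ < 1) (n : ℕ) :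
    ‖x ^ n - 1‖ < 1 := by
  induction n with
  | zero => rw [pow_zero, sub_self, norm_zero]; exact one_pos
  | succ n ih => rw [pow_succ]; exact PadicAlgCl.norm_mul_sub_one_lt ih hx

/-- `U¹` is closed under integral powers. [folklore] -/
theorem PadicAlgCl.norm_zpow_sub_one_lt {x : PadicAlgCl p} (hx : ‖x - 1‖ < 1) (n : ℤ) :
    ‖x ^ n - 1‖ < 1 := by
  cases n with
  | ofNat n => rw [Int.ofNat_eq_natCast, zpow_natCast]; exact PadicAlgCl.norm_pow_sub_one_lt hx n
  | negSucc n =>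
    rw [zpow_negSucc]
    exact PadicAlgCl.norm_inv_sub_one_lt (PadicAlgCl.norm_pow_sub_one_lt hx _)

/-- For `‖x‖ ≤ 1`, `‖x^k - 1‖ ≤ ‖x - 1‖` (`x^k - 1 = (x - 1) ∑_{i<k} x^i`). [folklore] -/
theorem PadicAlgCl.norm_pow_sub_one_le {x : PadicAlgCl p} (hx : ‖x‖ ≤ 1) (k : ℕ) :
    ‖x ^ k - 1‖ ≤ ‖x - 1‖ := by
  rw [← geom_sum_mul, norm_mul]
  refine mul_le_of_le_one_left (norm_nonneg _) ?_
  refine IsUltrametricDist.norm_sum_le_of_forall_le_of_nonneg zero_le_one fun i _ => ?_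
  rw [norm_pow]
  exact pow_le_one₀ (norm_nonneg _) hx

/-- The principal units `U¹ = {u : ‖u - 1‖ < 1}` as a subgroup of `ℚ̄_pˣ`. [folklore] -/
def PadicAlgCl.principalUnits (p : ℕ) [Fact p.Prime] : Subgroup (PadicAlgCl p)ˣ where
  carrier := {u | ‖(u : PadicAlgCl p) - 1‖ < 1}
  mul_mem' ha hb := by
    change ‖((_ * _ : (PadicAlgCl p)ˣ) : PadicAlgCl p) - 1‖ < 1
    rw [Units.val_mul]; exact PadicAlgCl.norm_mul_sub_one_lt ha hb
  one_mem' := by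
    change ‖((1 : (PadicAlgCl p)ˣ) : PadicAlgCl p) - 1‖ < 1
    rw [Units.val_one, sub_self, norm_zero]; exact one_pos
  inv_mem' ha := by
    change ‖((_⁻¹ : (PadicAlgCl p)ˣ) : PadicAlgCl p) - 1‖ < 1
    rw [Units.val_inv_eq_inv_val]; exact PadicAlgCl.norm_inv_sub_one_lt ha

/-- Membership in `principalUnits`. [folklore] -/
@[simp] theorem PadicAlgCl.mem_principalUnits_iff {u : (PadicAlgCl p)ˣ} :
    u ∈ PadicAlgCl.principalUnits p ↔ ‖(u : PadicAlgCl p) - 1‖ < 1 := Iff.rfl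

/-- `principalUnits` is open in `ℚ̄_pˣ`. [folklore] -/
theorem PadicAlgCl.isOpen_principalUnits :
    IsOpen (PadicAlgCl.principalUnits p : Set (PadicAlgCl p)ˣ) := by
  have : (PadicAlgCl.principalUnits p : Set (PadicAlgCl p)ˣ) =
      (fun u : (PadicAlgCl p)ˣ => (u : PadicAlgCl p)) ⁻¹' Metric.ball (1 : PadicAlgCl p) 1 := by
    ext u; simp [dist_eq_norm]
  rw [this]
  exact Metric.isOpen_ball.preimage Units.continuous_val

/-! ### `x ↦ x^N` is an isometry of `U¹` for `p ∤ N` -/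

/-- For `x, y ∈ U¹` and `p ∤ N`: `‖∑_{i<N} x^i y^{N-1-i}‖ = 1` (the sum is `≡ N (mod 𝔪)` and
`‖N‖ = 1`). [folklore] -/
theorem PadicAlgCl.norm_geom_sum₂_eq_one {N : ℕ} (hN : ¬p ∣ N) {x y : PadicAlgCl p}
    (hx : ‖x - 1‖ < 1) (hy : ‖y - 1‖ < 1) :
    ‖∑ i ∈ range N, x ^ i * y ^ (N - 1 - i)‖ = 1 := by
  have hN0 : N ≠ 0 := fun h => hN (h ▸ dvd_zero p)
  set S := ∑ i ∈ range N, x ^ i * y ^ (N - 1 - i) with hS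
  -- `‖S - N‖ < 1`
  have hdiff : S - N = ∑ i ∈ range N, (x ^ i * y ^ (N - 1 - i) - 1) := by
    rw [Finset.sum_sub_distrib, Finset.sum_const, Finset.card_range, nsmul_eq_mul, mul_one]
  have hlt : ‖S - N‖ < 1 := by
    rw [hdiff]
    have hne : (range N).Nonempty := Finset.nonempty_range_iff.2 hN0
    refine lt_of_le_of_lt (hne.norm_sum_le_sup'_norm _) ?_
    rw [Finset.sup'_lt_iff]
    intro i _
    exact PadicAlgCl.norm_mul_sub_one_lt (PadicAlgCl.norm_pow_sub_one_lt hx _)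
      (PadicAlgCl.norm_pow_sub_one_lt hy _)
  have hNn : ‖(N : PadicAlgCl p)‖ = 1 := PadicAlgCl.norm_natCast_eq_one_of_not_dvd' hN
  have hne : ‖S - N‖ ≠ ‖(N : PadicAlgCl p)‖ := by rw [hNn]; exact hlt.ne
  have := IsUltrametricDist.norm_add_eq_max_of_norm_ne_norm hne
  rwa [sub_add_cancel, hNn, max_eq_right hlt.le] at this

/-- **`x ↦ x^N` is an isometry of the principal units** (`p ∤ N`): `‖x^N - y^N‖ = ‖x - y‖` for
`x, y ∈ U¹`.  Serre, *Local Fields*, XIV §4 (the filtration of `U¹`). [folklore] -/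
theorem PadicAlgCl.norm_pow_sub_pow_eq {N : ℕ} (hN : ¬p ∣ N) {x y : PadicAlgCl p}
    (hx : ‖x - 1‖ < 1) (hy : ‖y - 1‖ < 1) : ‖x ^ N - y ^ N‖ = ‖x - y‖ := by
  rw [← geom_sum₂_mul, norm_mul, PadicAlgCl.norm_geom_sum₂_eq_one hN hx hy, one_mul]

/-- `x ↦ x^N` is injective on the principal units (`p ∤ N`). [folklore] -/
theorem PadicAlgCl.eq_of_pow_eq_pow {N : ℕ} (hN : ¬p ∣ N) {x y : PadicAlgCl p} (hx : ‖x - 1‖ < 1)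
    (hy : ‖y - 1‖ < 1) (h : x ^ N = y ^ N) : x = y := by
  have h0 : ‖x - y‖ = 0 := by
    rw [← PadicAlgCl.norm_pow_sub_pow_eq hN hx hy, h, sub_self, norm_zero]
  exact sub_eq_zero.1 (norm_eq_zero.1 h0)

/-- An auxiliary real inequality: a multiset product of reals `≥ 1` is `≥ 1`. [folklore] -/
theorem one_le_multiset_prod_map {ι : Type*} (s : Multiset ι) (g : ι → ℝ) (h : ∀ i ∈ s, 1 ≤ g i) :
    1 ≤ (s.map g).prod := by
  induction s using Multiset.induction_on with
  | empty => simp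
  | cons a s ih =>
    rw [Multiset.map_cons, Multiset.prod_cons]
    exact one_le_mul_of_one_le_of_one_le (h a (Multiset.mem_cons_self a s))
      (ih fun i hi => h i (Multiset.mem_cons_of_mem hi))

/-- `‖∏ s‖ = ∏ ‖·‖` over a multiset, in a normed field. [folklore] -/
theorem norm_multiset_prod_eq {K : Type*} [NormedField K] (s : Multiset K) :
    ‖s.prod‖ = (s.map fun a => ‖a‖).prod := by
  induction s using Multiset.induction_on with
  | empty => simp
  | cons a s ih => rw [Multiset.prod_cons, Multiset.map_cons, Multiset.prod_cons, norm_mul, ih]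

/-- **`x ↦ x^N` is onto the principal units** (`N ≥ 1`): for `u ∈ U¹` some root `z` of `X^N - u`
in the algebraically closed `ℚ̄_p` lies in `U¹`, because `∏_i (1 - z_i) = 1 - u` has norm `< 1`
while every factor has norm `≤ 1`-or-more. [folklore] -/
theorem PadicAlgCl.exists_norm_sub_one_lt_and_pow_eq {N : ℕ} (hN : 0 < N) {u : PadicAlgCl p}
    (hu : ‖u - 1‖ < 1) : ∃ x : PadicAlgCl p, ‖x - 1‖ < 1 ∧ x ^ N = u := by
  set f : (PadicAlgCl p)[X] := X ^ N - C u with hf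
  have hmonic : f.Monic := monic_X_pow_sub_C u hN.ne'
  have hsplit : f.Splits := IsAlgClosed.splits f
  have heval : f.eval 1 = (f.roots.map fun a => (1 : PadicAlgCl p) - a).prod :=
    hsplit.eval_eq_prod_roots_of_monic hmonic 1
  have hev1 : f.eval 1 = 1 - u := by simp [hf]
  by_contra hcon
  have hcon' : ∀ x : PadicAlgCl p, ‖x - 1‖ < 1 → x ^ N ≠ u := fun x hx hxu => hcon ⟨x, hx, hxu⟩
  -- every root `a` has `a ^ N = u`, hence is not in `U¹`, hence `‖1 - a‖ ≥ 1`
  have hroot : ∀ a ∈ f.roots, 1 ≤ ‖(1 : PadicAlgCl p) - a‖ := by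
    intro a ha
    have haN : a ^ N = u := by
      have := (mem_roots hmonic.ne_zero).1 ha
      rw [IsRoot.def, hf, eval_sub, eval_pow, eval_X, eval_C, sub_eq_zero] at this
      exact this
    have hna : ¬‖a - 1‖ < 1 := fun h => hcon' a h haN
    rw [← norm_neg, neg_sub]
    exact not_lt.1 hna
  have h1 : 1 ≤ ‖(1 : PadicAlgCl p) - u‖ := by
    rw [← hev1, heval]
    have : ‖(f.roots.map fun a => (1 : PadicAlgCl p) - a).prod‖ =
        (f.roots.map fun a => ‖(1 : PadicAlgCl p) - a‖).prod := by
      rw [norm_multiset_prod_eq, Multiset.map_map]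
      rfl
    rw [this]
    exact one_le_multiset_prod_map _ _ hroot
  rw [← norm_neg, neg_sub] at hu
  exact absurd hu (not_lt.2 h1)

/-! ### `N`-th roots of characters with values in the principal units -/

/-- **Uniqueness of principal `N`-th roots**: two maps `ξ, ξ' : G → ℚ̄_p` with values in `U¹` and
the same `N`-th powers coincide (`p ∤ N`). [folklore] -/
theorem eq_of_pow_eq_pow_of_norm_sub_one_lt {N : ℕ} (hN : ¬p ∣ N) {G : Type*}
    {ξ ξ' : G → PadicAlgCl p} (hξ : ∀ g, ‖ξ g - 1‖ < 1) (hξ' : ∀ g, ‖ξ' g - 1‖ < 1)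
    (h : ∀ g, ξ g ^ N = ξ' g ^ N) : ξ = ξ' :=
  funext fun g => PadicAlgCl.eq_of_pow_eq_pow hN (hξ g) (hξ' g) (h g)

/-- **Continuous `N`-th roots of `p`-adic characters with values in the principal units
(`p ∤ N`).**  For a topological group `G` and a continuous character `χ : G →ₜ* ℚ̄_pˣ` with
`‖χ(g) - 1‖ < 1` for all `g` there is a continuous character `ξ : G →ₜ* ℚ̄_pˣ`, again with
values in `U¹`, with `ξ(g)^N = χ(g)`: `ξ(g)` is the `N`-th root of `χ(g)` in `U¹`
(`exists_norm_sub_one_lt_and_pow_eq`), multiplicative by uniqueness (`eq_of_pow_eq_pow`) and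
continuous because `x ↦ x^N` is an isometry of `U¹` (`norm_pow_sub_pow_eq`).  This is the unique
divisibility of the pro-`p` group `U¹` by `N ∈ ℤ_pˣ` (Serre, *Local Fields* XIV §4 Prop. 10);
the case `N = 2` is `exists_continuousMonoidHom_sq_eq_of_norm_sub_one_lt`
(`PadicCharacterSquareRoot`, Taylor 2006 p. 777). [cite: SerreLocalFields1979, Ch. XIV §4 Prop. 10] -/
theorem exists_continuousMonoidHom_pow_eq_of_norm_sub_one_lt {N : ℕ} (hN : ¬p ∣ N) {G : Type*}
    [Group G] [TopologicalSpace G] [IsTopologicalGroup G] (χ : G →ₜ* (PadicAlgCl p)ˣ)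
    (hχ : ∀ g, ‖((χ g : (PadicAlgCl p)ˣ) : PadicAlgCl p) - 1‖ < 1) :
    ∃ ξ : G →ₜ* (PadicAlgCl p)ˣ, (∀ g, ξ g ^ N = χ g) ∧
      ∀ g, ‖((ξ g : (PadicAlgCl p)ˣ) : PadicAlgCl p) - 1‖ < 1 := by
  classical
  have hN0 : 0 < N := Nat.pos_of_ne_zero fun h => hN (h ▸ dvd_zero p)
  have hex : ∀ g, ∃ x : PadicAlgCl p, ‖x - 1‖ < 1 ∧ x ^ N = (χ g : PadicAlgCl p) :=
    fun g => PadicAlgCl.exists_norm_sub_one_lt_and_pow_eq hN0 (hχ g)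
  choose f hf1 hf2 using hex
  have hmul : ∀ g h, f (g * h) = f g * f h := by
    intro g h
    refine PadicAlgCl.eq_of_pow_eq_pow hN (hf1 _) (PadicAlgCl.norm_mul_sub_one_lt (hf1 g) (hf1 h)) ?_
    rw [hf2, mul_pow, hf2, hf2, map_mul, Units.val_mul]
  have hone : f 1 = 1 := by
    refine PadicAlgCl.eq_of_pow_eq_pow hN (hf1 _) (by rw [sub_self, norm_zero]; exact one_pos) ?_
    rw [hf2, map_one, Units.val_one, one_pow]
  let F : G →* PadicAlgCl p := ⟨⟨f, hone⟩, hmul⟩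
  have hχc : Continuous fun g => ((χ g : (PadicAlgCl p)ˣ) : PadicAlgCl p) :=
    Units.continuous_val.comp χ.continuous
  have hfc : Continuous f := by
    refine continuous_iff_continuousAt.2 fun g₀ => ?_
    rw [ContinuousAt, Metric.tendsto_nhds]
    intro ε hε
    have h := Metric.tendsto_nhds.1 (hχc.continuousAt (x := g₀)) ε hε
    refine h.mono fun g hg => ?_
    rw [dist_eq_norm] at hg ⊢
    rw [← PadicAlgCl.norm_pow_sub_pow_eq hN (hf1 g) (hf1 g₀), hf2, hf2]
    exact hg
  refine ⟨⟨F.toHomUnits, ?_⟩, fun g => Units.ext ?_, fun g => ?_⟩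
  · refine Units.continuous_iff.2 ⟨hfc, ?_⟩
    have : (fun g => (((F.toHomUnits g)⁻¹ : (PadicAlgCl p)ˣ) : PadicAlgCl p)) = fun g => f g⁻¹ := by
      funext g
      rw [← map_inv, MonoidHom.coe_toHomUnits]
      rfl
    change Continuous fun g => (((F.toHomUnits g)⁻¹ : (PadicAlgCl p)ˣ) : PadicAlgCl p)
    rw [this]
    exact hfc.comp continuous_inv
  · change (((F.toHomUnits g) ^ N : (PadicAlgCl p)ˣ) : PadicAlgCl p) = χ g
    rw [Units.val_pow_eq_pow_val, MonoidHom.coe_toHomUnits]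
    exact hf2 g
  · change ‖((F.toHomUnits g : (PadicAlgCl p)ˣ) : PadicAlgCl p) - 1‖ < 1
    rw [MonoidHom.coe_toHomUnits]
    exact hf1 g

/-! ### No `p`-torsion in `𝒪ˣ/U¹` (`p` odd) -/

/-- For `p` odd and `‖y‖ ≤ 1`: `‖(y - 1)^p - (y^p - 1)‖ ≤ ‖p‖`, from the binomial theorem (the
extreme terms of `(y + (-1))^p` are `y^p` and `(-1)^p = -1`, the others are multiples of `p`).
[folklore] -/
theorem PadicAlgCl.norm_sub_one_pow_sub_le (hp : p ≠ 2) {y : PadicAlgCl p} (hy : ‖y‖ ≤ 1) :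
    ‖(y - 1) ^ p - (y ^ p - 1)‖ ≤ ‖(p : PadicAlgCl p)‖ := by
  have hodd : Odd p := (Fact.out : p.Prime).odd_of_ne_two hp
  have hp2 : 2 ≤ p := (Fact.out : p.Prime).two_le
  obtain ⟨q, hq⟩ : ∃ q, p = q + 2 := ⟨p - 2, by omega⟩
  have hexp : (y - 1) ^ p = ∑ j ∈ range (p + 1), y ^ j * (-1) ^ (p - j) * (p.choose j : PadicAlgCl p) := by
    rw [sub_eq_add_neg, add_pow]
  have hsplit : ∑ j ∈ range (p + 1), y ^ j * (-1) ^ (p - j) * (p.choose j : PadicAlgCl p) =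
      (-1) + (∑ j ∈ range (q + 1), y ^ (j + 1) * (-1) ^ (p - (j + 1)) * (p.choose (j + 1) : PadicAlgCl p)) + y ^ p := by
    have hr : range (p + 1) = range (q + 1 + 1 + 1) := by rw [hq]
    rw [hr, Finset.sum_range_succ, Finset.sum_range_succ']
    have hq' : q + 1 + 1 = p := by omega
    simp only [hq', pow_zero, Nat.choose_zero_right, Nat.cast_one, mul_one, Nat.sub_zero, one_mul,
      hodd.neg_one_pow, Nat.choose_self, Nat.sub_self]
    ring
  have hmid : ‖∑ j ∈ range (q + 1), y ^ (j + 1) * (-1) ^ (p - (j + 1)) * (p.choose (j + 1) : PadicAlgCl p)‖ ≤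
      ‖(p : PadicAlgCl p)‖ := by
    refine IsUltrametricDist.norm_sum_le_of_forall_le_of_nonneg (norm_nonneg _) fun j hj => ?_
    rw [Finset.mem_range] at hj
    rw [norm_mul, norm_mul, norm_pow, norm_pow, norm_neg, norm_one, one_pow, mul_one]
    have hc : ‖((p.choose (j + 1) : ℕ) : PadicAlgCl p)‖ ≤ ‖(p : PadicAlgCl p)‖ :=
      PadicAlgCl.norm_choose_le_norm_p (by omega) (by omega)
    calc ‖y‖ ^ (j + 1) * ‖((p.choose (j + 1) : ℕ) : PadicAlgCl p)‖
        ≤ 1 * ‖(p : PadicAlgCl p)‖ :=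
          mul_le_mul (pow_le_one₀ (norm_nonneg _) hy) hc (norm_nonneg _) zero_le_one
      _ = ‖(p : PadicAlgCl p)‖ := one_mul _
  have hid : (y - 1) ^ p - (y ^ p - 1) =
      ∑ j ∈ range (q + 1), y ^ (j + 1) * (-1) ^ (p - (j + 1)) * (p.choose (j + 1) : PadicAlgCl p) := by
    rw [hexp, hsplit]; ring
  rw [hid]
  exact hmid

/-- **`‖y^p - 1‖ < 1 ⇒ ‖y - 1‖ < 1`** for `p` odd and `‖y‖ ≤ 1`: the quotient `𝒪ˣ/U¹ ≅ 𝔽̄_pˣ`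
has no `p`-torsion. [folklore] -/
theorem PadicAlgCl.norm_sub_one_lt_of_norm_pow_sub_one_lt (hp : p ≠ 2) {y : PadicAlgCl p}
    (hy : ‖y‖ ≤ 1) (h : ‖y ^ p - 1‖ < 1) : ‖y - 1‖ < 1 := by
  have hle := PadicAlgCl.norm_sub_one_pow_sub_le hp hy
  have hpow : ‖(y - 1) ^ p‖ < 1 := by
    have : (y - 1) ^ p = ((y - 1) ^ p - (y ^ p - 1)) + (y ^ p - 1) := by ring
    rw [this]
    refine lt_of_le_of_lt (IsUltrametricDist.norm_add_le_max _ _) (max_lt ?_ h)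
    exact hle.trans_lt (PadicAlgCl.norm_natCast_lt_one_of_dvd (dvd_refl p))
  rw [norm_pow] at hpow
  exact (pow_lt_one_iff_of_nonneg (norm_nonneg _) (Fact.out : p.Prime).ne_zero).1 hpow

/-- Iterate: `‖y^{p^a} - 1‖ < 1 ⇒ ‖y - 1‖ < 1` (`p` odd, `‖y‖ ≤ 1`). [folklore] -/
theorem PadicAlgCl.norm_sub_one_lt_of_norm_pow_prime_pow_sub_one_lt (hp : p ≠ 2) {y : PadicAlgCl p}
    (hy : ‖y‖ ≤ 1) {a : ℕ} (h : ‖y ^ p ^ a - 1‖ < 1) : ‖y - 1‖ < 1 := by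
  induction a generalizing y with
  | zero => rwa [pow_zero, pow_one] at h
  | succ a ih =>
    rw [pow_succ, pow_mul] at h
    have hya : ‖y ^ p ^ a‖ ≤ 1 := by rw [norm_pow]; exact pow_le_one₀ (norm_nonneg _) hy
    exact ih hy (PadicAlgCl.norm_sub_one_lt_of_norm_pow_sub_one_lt hp hya h)

/-! ### Compact sources -/

section Compact

variable {G : Type*} [Group G] [TopologicalSpace G] [IsTopologicalGroup G]

/-- **A homomorphism with open kernel on a compact group has values of bounded finite order**:
`f(g)^d = 1` for all `g`, with `d = [G : ker f] ≥ 1`. [folklore] -/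
theorem exists_pow_eq_one_of_isOpen_ker [CompactSpace G] {H : Type*} [Group H] (f : G →* H)
    (hf : IsOpen (f.ker : Set G)) : ∃ d : ℕ, 0 < d ∧ ∀ g, f g ^ d = 1 := by
  -- an open subgroup of a compact group has finite index (coset space compact and discrete; the
  -- tree's `finiteIndex_of_isOpen_of_compactSpace` of `EulerSystem`, not imported here)
  haveI : DiscreteTopology (G ⧸ f.ker) := QuotientGroup.discreteTopology hf
  haveI : Finite (G ⧸ f.ker) := finite_of_compact_of_discrete
  haveI : f.ker.FiniteIndex := Subgroup.finiteIndex_of_finite_quotient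
  refine ⟨f.ker.index, Nat.pos_of_ne_zero Subgroup.FiniteIndex.index_ne_zero, fun g => ?_⟩
  rw [← map_pow]
  exact f.mem_ker.1 (Subgroup.pow_index_mem f.ker g)

omit [IsTopologicalGroup G] in
/-- A continuous character of a compact group into `ℚ̄_pˣ` has values of norm `1` (its image is
a compact, hence bounded, subgroup of `ℚ̄_pˣ`). [folklore] -/
theorem norm_apply_eq_one_of_compactSpace [CompactSpace G] (Θ : G →ₜ* (PadicAlgCl p)ˣ) (g : G) :
    ‖((Θ g : (PadicAlgCl p)ˣ) : PadicAlgCl p)‖ = 1 := by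
  -- the norms of the values are bounded
  have hc : Continuous fun g : G => ‖((Θ g : (PadicAlgCl p)ˣ) : PadicAlgCl p)‖ :=
    continuous_norm.comp (Units.continuous_val.comp Θ.continuous)
  obtain ⟨C, hC⟩ := (isCompact_range hc).isBounded.bddAbove
  have hle : ∀ g : G, ‖((Θ g : (PadicAlgCl p)ˣ) : PadicAlgCl p)‖ ≤ 1 := by
    intro g
    by_contra hgt
    rw [not_le] at hgt
    obtain ⟨n, hn⟩ := pow_unbounded_of_one_lt C hgt
    have hmem : ‖((Θ (g ^ n) : (PadicAlgCl p)ˣ) : PadicAlgCl p)‖ ≤ C := hC ⟨g ^ n, rfl⟩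
    rw [map_pow, Units.val_pow_eq_pow_val, norm_pow] at hmem
    exact absurd hmem (not_le.2 hn)
  refine le_antisymm (hle g) ?_
  have hinv := hle g⁻¹
  rw [map_inv, Units.val_inv_eq_inv_val, norm_inv] at hinv
  have hpos : 0 < ‖((Θ g : (PadicAlgCl p)ˣ) : PadicAlgCl p)‖ := norm_pos_iff.2 (Θ g).ne_zero
  exact (inv_le_one₀ hpos).1 hinv

/-- **The prime-to-`p` residual order**: for `p` odd, a compact group `G` and a continuous
`Θ : G →ₜ* ℚ̄_pˣ` there is `d ≥ 1` with `p ∤ d` such that `Θ(g)^d ∈ U¹` for every `g` — the open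
subgroup `Θ⁻¹(U¹)` has finite index `p^a d`, and `p`-th powers descend in `𝒪ˣ/U¹`
(`norm_sub_one_lt_of_norm_pow_prime_pow_sub_one_lt`).  This is the reduction "replace `θ` by a
prime-to-`l` power to make it residually trivial" (the residual image is a finite subgroup of
`𝔽̄_lˣ`, of order prime to `l`). [folklore] -/
theorem exists_pow_norm_sub_one_lt_of_compactSpace (hp : p ≠ 2) [CompactSpace G]
    (Θ : G →ₜ* (PadicAlgCl p)ˣ) :
    ∃ d : ℕ, 0 < d ∧ ¬p ∣ d ∧ ∀ g, ‖((Θ g : (PadicAlgCl p)ˣ) : PadicAlgCl p) ^ d - 1‖ < 1 := by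
  set H : Subgroup G := (PadicAlgCl.principalUnits p).comap Θ.toMonoidHom with hH
  have hHopen : IsOpen (H : Set G) := PadicAlgCl.isOpen_principalUnits.preimage Θ.continuous
  haveI : DiscreteTopology (G ⧸ H) := QuotientGroup.discreteTopology hHopen
  haveI : Finite (G ⧸ H) := finite_of_compact_of_discrete
  haveI : H.FiniteIndex := Subgroup.finiteIndex_of_finite_quotient
  have hidx : H.index ≠ 0 := Subgroup.FiniteIndex.index_ne_zero
  obtain ⟨a, d, hd, hfac⟩ := Nat.exists_eq_pow_mul_and_not_dvd hidx p (Fact.out : p.Prime).one_lt.ne'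
  have hd0 : 0 < d := Nat.pos_of_ne_zero fun h => hidx (by rw [hfac, h, mul_zero])
  refine ⟨d, hd0, hd, fun g => ?_⟩
  have hmem : g ^ H.index ∈ H := Subgroup.pow_index_mem H g
  have hval : ‖((Θ g : (PadicAlgCl p)ˣ) : PadicAlgCl p) ^ (p ^ a * d) - 1‖ < 1 := by
    have := (Subgroup.mem_comap.1 hmem)
    rw [PadicAlgCl.mem_principalUnits_iff, ContinuousMonoidHom.coe_toMonoidHom, map_pow,
      Units.val_pow_eq_pow_val, hfac] at this
    exact this
  rw [mul_comm, pow_mul] at hval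
  have hy : ‖((Θ g : (PadicAlgCl p)ˣ) : PadicAlgCl p) ^ d‖ ≤ 1 := by
    rw [norm_pow, norm_apply_eq_one_of_compactSpace Θ g, one_pow]
  exact PadicAlgCl.norm_sub_one_lt_of_norm_pow_prime_pow_sub_one_lt hp hy hval

end Compact

end Literature.NumberTheory.GaloisRepresentations

end
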